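import Summits.Ventures.CertifiedManyBodySolver.Theses.TcThermcert1
import HarnessLib

/-!
# Sketch (planner hub-tc-therm-idea-1, crux-ideate on thermcert-1 K1): the ZERO-FREE β-CORRIDOR transfer

Idea card `idea-zero-free-corridor.md` on crux K1 = `TcThermcert1.ThermalStiffnessCeilingU8b10_le_1o8` (item stmt-Ventures-26381) of
route-Ventures-TcThermcert1 (born 2026-08-28T06:56Z, draft). The route module is imported; `k1_byName` / `k2box_byName` conclude the
route decls BY NAME.

* `TwistInsensitiveAt` — qualitative twist-insensitivity of the `(N_L, S^z = 0)` sector free energy at ONE `β`.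
* `leafAtBeta_of_twistInsensitiveAt` — PROVED: twist-insensitivity at `β` ⇒ the thermal stiffness leaf at `β` for every `c ≥ 0`
  (the canonical-sector twin of pub-hubbard's `highTemperatureNoThermalStiffnessTT'CanonicalN_of_insensitivity`).
* `fluxBlock`, `thermalFluxZc` — the sector block of `hubbardTorusTT'Flux` and its partition function at COMPLEX inverse temperature (entire in `β`).
* `FluxBlindTracePow` — SUPPORT statement (exact combinatorics): `tr_p H_L(θ)^k = tr_p H_L(0)^k` for every `k < L` (a closed walk of fewer
  than `L` hops cannot wind the torus), i.e. `g_L(β,θ) = log Z_L(β,0) − log Z_L(β,θ)` vanishes to ORDER `L` at `β = 0`.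
* `ZeroFreeStrip` — Hypothesis Z: an `L`-uniform zero-free rectangle around the temperature segment `[0, β₁]` for small twists.
* §3 `corridor_transfer` — the FIRST LEMMA (pure complex analysis, signature only): two zero-free corridor-admissible functions agreeing to order `L`
  at `0` have logs at `b` within `C (M+1) r^L`; model inputs `corridorData_thermalFluxZc` (a-priori bounds + Hypothesis Z) and
  `iteratedDeriv_thermalFluxZc_eq` (flux-blindness = flatness), signatures only; `twistInsensitiveAt_of_zeroFreeStrip` is PROVED from these three.
* `k1_of_zeroFreeStrip` — the K1 reading at `(t′, U, n, β) = (0, 8, 7/8, 10)`; `k2box_of_zeroFreeStrip` — the packet-v4 K2 consequent on the box.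
-/

noncomputable section

namespace Summit.Ventures.CertifiedManyBodySolver.Theses.TcThermcert1.ZeroFreeCorridor

open Filter Topology Set Real Matrix
open Literature.MathematicalPhysics.QuantumLattice
open Literature.MathematicalPhysics.QuantumFieldTheory
open Literature.Probability.LatticeModels
open Summit.Ventures.CertifiedManyBodySolver.Observables
open scoped ComplexConjugate ComplexOrder

/-- Qualitative twist-insensitivity of the `(N_L, S^z=0)` sector free energy at inverse temperature `β`:
for some flux scale `θ₁ > 0`, `|log Z_L(0) − log Z_L(θ)| ≤ ε_L → 0` uniformly in `|θ| ≤ θ₁`. -/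
def TwistInsensitiveAt (tp U n β : ℝ) : Prop :=
  ∃ θ₁ : ℝ, 0 < θ₁ ∧ ∃ ε : ℕ → ℝ, Tendsto ε atTop (𝓝 0) ∧ ∃ L₀ : ℕ,
    ∀ (L : ℕ) [NeZero L], L₀ ≤ L → ∀ θ : ℝ, |θ| ≤ θ₁ →
      |thermalFluxLogZ L tp U (1 - n) β 0 - thermalFluxLogZ L tp U (1 - n) β θ| ≤ ε L

/-- **Socket (PROVED).** Twist-insensitivity at `β > 0` forces the single-temperature thermal stiffness leaf for every `c ≥ 0`. -/
theorem leafAtBeta_of_twistInsensitiveAt {tp U n β : ℝ} (hβ : 0 < β) {c : ℚ} (_hc : 0 ≤ c)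
    (h : TwistInsensitiveAt tp U n β) : ObsThermalStiffnessSeqCeilingAtBeta tp U n β c := by
  intro ρs θ₀ hρs hθ₀ Ls hLs hst
  obtain ⟨θ₁, hθ₁, ε, hε, L₀, hins⟩ := h
  exfalso
  set θ : ℝ := min θ₀ θ₁ with hθdef
  have hθpos : 0 < θ := lt_min hθ₀ hθ₁
  have hθ0 : |θ| ≤ θ₀ := by rw [abs_of_pos hθpos]; exact min_le_left _ _
  have hθ1 : |θ| ≤ θ₁ := by rw [abs_of_pos hθpos]; exact min_le_right _ _
  -- eventually `Ls j ≥ max 1 L₀`, and then `β ρs θ² ≤ ε (Ls j)`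
  have hev : ∀ᶠ j in atTop, β * ρs * θ ^ 2 ≤ ε (Ls j) := by
    have h1 : ∀ᶠ j in atTop, max 1 L₀ ≤ Ls j := hLs.eventually (eventually_ge_atTop (max 1 L₀))
    filter_upwards [h1] with j hj
    haveI : NeZero (Ls j) := ⟨by omega⟩
    have ha := hst j θ hθ0
    have hb := hins (Ls j) (le_of_max_le_right hj) θ hθ1
    exact ha.trans ((le_abs_self _).trans hb)
  have hlim : Tendsto (fun j => ε (Ls j)) atTop (𝓝 0) := hε.comp hLs
  have hle : β * ρs * θ ^ 2 ≤ 0 := ge_of_tendsto hlim hev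
  have hpos : 0 < β * ρs * θ ^ 2 := by positivity
  linarith

/-- The `(N_L, S^z = 0)` coordinate sector of the `t–t′` torus at doping `δ` (the binder of `thermalFluxLogZ`). -/
def fluxSector (L : ℕ) (δ : ℝ) (s : Finset (Orb (FermionTorus 2 L))) : Prop :=
  s.card = 2 * ⌊(1 - δ) * (L : ℝ) ^ 2 / 2⌋₊ ∧
    2 * (s.filter fun i => (ofLex i).2 = 0).card = 2 * ⌊(1 - δ) * (L : ℝ) ^ 2 / 2⌋₊

instance (L : ℕ) (δ : ℝ) : DecidablePred (fluxSector L δ) := fun _ => by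
  unfold fluxSector; infer_instance

/-- The `(N_L, S^z=0)` sector block of the seam-flux Hamiltonian `hubbardTorusTT'Flux L tp U θ` at doping `δ`. -/
def fluxBlock (L : ℕ) [NeZero L] (tp U δ θ : ℝ) :
    Matrix {a // fluxSector L δ a} {a // fluxSector L δ a} ℂ :=
  (hubbardTorusTT'Flux L tp U θ).toBlock (fluxSector L δ) (fluxSector L δ)

/-- The sector partition function at COMPLEX inverse temperature: `Z_L(β, θ) = tr_sector e^{−β H_L(θ)}`, an exponential polynomial
in `β` (entire); for real `β` its value is `partitionFn β (sector block)`, whose `Re`-log is `thermalFluxLogZ`. -/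
def thermalFluxZc (L : ℕ) [NeZero L] (tp U δ θ : ℝ) (β : ℂ) : ℂ :=
  (NormedSpace.exp (-β • fluxBlock L tp U δ θ)).trace

/-- **Support statement (flux-blindness of short walks; exact).** The first `L − 1` sector moments do not see the seam flux:
`tr_p H_L(θ)^k = tr_p H_L(0)^k` for `k < L`. Reason: in the occupation basis `tr_p H^k` is a sum over closed walks of `k` hop/diagonal
steps; a closed walk with net signed seam crossing `S` has at least `L·|S|` hops (the sum of x-coordinates is invariant), and its
`θ`-dependence is `e^{iθS}`. Consequence: `β ↦ Z_L(β,θ) − Z_L(β,0)` has a zero of order `≥ L` at `β = 0`. -/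
def FluxBlindTracePow (L : ℕ) [NeZero L] (tp U δ θ : ℝ) : Prop :=
  ∀ k : ℕ, k < L → (fluxBlock L tp U δ θ ^ k).trace = (fluxBlock L tp U δ 0 ^ k).trace

/-- **Hypothesis Z (zero-free β-strip, uniform in `L` and in small twists).** For all large `L` and all `|θ| ≤ θ₁` the sector partition
function `β ↦ Z_L(β, θ)` has no zero in the open rectangle `(−η, β₁ + η) × (−η, η)·i`. Reading: no Fisher zero of the twisted family
approaches the real temperature segment `[0, β₁]` — no phase transition for `T ≥ 1/β₁`, in the Lee–Yang–Fisher sense. (Near `β = 0`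
this is the Kotecký–Preiss disc of pub-hubbard Thm 12/13; the extension to `β₁ = 10` is the BET of the line.) -/
def ZeroFreeStrip (tp U n β₁ η θ₁ : ℝ) : Prop :=
  ∃ L₀ : ℕ, ∀ (L : ℕ) [NeZero L], L₀ ≤ L → ∀ θ : ℝ, |θ| ≤ θ₁ →
    ∀ β : ℂ, -η < β.re → β.re < β₁ + η → |β.im| < η → thermalFluxZc L tp U (1 - n) θ β ≠ 0

/-! ## 3. The corridor transfer — pure complex analysis (the M-sized first target), and the two model inputs -/

/-- The open corridor `(−η, b + η) × (−η, η)·i` around the real segment `[0, b]`. -/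
def corridor (η b : ℝ) : Set ℂ := {z : ℂ | -η < z.re ∧ z.re < b + η ∧ |z.im| < η}

/-- Admissible corridor data with size parameter `M ≥ 0`: `f` is analytic and zero-free on the corridor, `‖f‖ ≤ e^{M}` there, and on the
real segment `f` is real with `f ≥ e^{−M}` (for a partition function: `|Z(β)| ≤ dim·e^{|β|‖H‖}`, `Z(x) ≥ e^{−|x|‖H‖}`, so `M = O(L²)`). -/
structure CorridorData (η b M : ℝ) (f : ℂ → ℂ) : Prop where
  differentiableOn : DifferentiableOn ℂ f (corridor η b)
  ne_zero : ∀ z ∈ corridor η b, f z ≠ 0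
  norm_le : ∀ z ∈ corridor η b, ‖f z‖ ≤ Real.exp M
  real_on_axis : ∀ x : ℝ, -η < x → x < b + η → (f x).im = 0 ∧ Real.exp (-M) ≤ (f x).re

/-- **Corridor transfer (abstract; the FIRST LEMMA, signature only).** Two admissible functions on the corridor that agree to order `L`
at `0` have logarithms at `b` that differ by at most `C·(M+1)·r^L`, with `C, r < 1` depending on `(η, b)` only. Proof route (all in
Mathlib/tree): `h := log (f/g)` exists on the simply connected corridor with `h(0) = 0` and `h` real on the axis; one-sided
Borel–Carathéodory (`Complex.borelCaratheodory_zero`, tree `Literature/Analysis/Complex/BorelCaratheodoryDeriv.lean`) on discs with REAL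
centres bounds `|log f − log f(x₀)|`, `|log g − log g(x₀)|` by `O(M)` on a shrunk corridor (only `Re log f = log ‖f‖ ≤ M` and
`log f(x₀) ≥ −M` are used); Schwarz at `0` (`h = O(z^L)`: `|h(z)| ≤ B (|z|/ρ)^L`); a fixed chain of Hadamard three-circles steps along
the axis carries the factor `(1/2)^{λⁿ L}` to `b`, so `r = 2^{−λⁿ} < 1`. -/
theorem corridor_transfer {η b : ℝ} (hη : 0 < η) (hb : 0 < b) :
    ∃ C r : ℝ, 0 < C ∧ 0 ≤ r ∧ r < 1 ∧
      ∀ (L : ℕ) (M : ℝ) (f g : ℂ → ℂ), 0 ≤ M → CorridorData η b M f → CorridorData η b M g →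
        (∀ k : ℕ, k < L → iteratedDeriv k f 0 = iteratedDeriv k g 0) →
        |Real.log (f b).re - Real.log (g b).re| ≤ C * (M + 1) * r ^ L := by
  sorry

/-- **Model input (a) (signature).** Under Hypothesis Z the twisted sector partition functions are corridor data with `M = A·L²`,
uniformly in `|θ| ≤ θ₁`: `Z_L(·,θ)` is entire; `|Z_L(β,θ)| ≤ 4^{L²} e^{|β| ‖H_L(θ)‖}` and `Z_L(x,θ) ≥ e^{−|x| ‖H_L(θ)‖}` with
`‖H_L(θ)‖ ≤ (8 + 8|t′| + U) L²` (Gershgorin); zero-freeness is Hypothesis Z itself. -/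
theorem corridorData_thermalFluxZc {tp U n b η θ₁ : ℝ} (hη : 0 < η) (hb : 0 < b) (hZ : ZeroFreeStrip tp U n b η θ₁) :
    ∃ A : ℝ, 0 ≤ A ∧ ∃ L₀ : ℕ, ∀ (L : ℕ) [NeZero L], L₀ ≤ L → ∀ θ : ℝ, |θ| ≤ θ₁ →
      CorridorData η b (A * (L : ℝ) ^ 2) (thermalFluxZc L tp U (1 - n) θ) := by
  sorry

/-- **Model input (b) (signature).** Flux-blindness is flatness of order `L` at `β = 0`:
`(d/dβ)^k tr e^{−βH} |_{β=0} = (−1)^k tr H^k`, so `FluxBlindTracePow` equates the first `L` Taylor coefficients of `Z_L(·,θ)` and `Z_L(·,0)`. -/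
theorem iteratedDeriv_thermalFluxZc_eq {L : ℕ} [NeZero L] {tp U δ θ : ℝ} (hF : FluxBlindTracePow L tp U δ θ) :
    ∀ k : ℕ, k < L → iteratedDeriv k (thermalFluxZc L tp U δ θ) 0 = iteratedDeriv k (thermalFluxZc L tp U δ 0) 0 := by
  sorry

/-- (c) The tree observable is the real log of the sector partition function at real `β` (definitional). -/
theorem thermalFluxLogZ_eq_log_re (L : ℕ) [NeZero L] (tp U δ b θ : ℝ) :
    thermalFluxLogZ L tp U δ b θ = Real.log (thermalFluxZc L tp U δ θ (b : ℂ)).re := by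
  rfl

/-- **Twist-insensitivity from the corridor (PROVED from §3's three signatures).** Flux-blindness (order-`L` flatness at `β = 0`) and a
zero-free corridor around `[0, β₁]` give `|g_L(β₁, θ)| ≤ C·(A L² + 1)·r^L → 0` uniformly in `|θ| ≤ θ₁`. -/
theorem twistInsensitiveAt_of_zeroFreeStrip {tp U n β₁ η θ₁ : ℝ} (hη : 0 < η) (hβ₁ : 0 < β₁) (hθ₁ : 0 < θ₁)
    (hF : ∀ (L : ℕ) [NeZero L] (θ : ℝ), FluxBlindTracePow L tp U (1 - n) θ)
    (hZ : ZeroFreeStrip tp U n β₁ η θ₁) : TwistInsensitiveAt tp U n β₁ := by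
  obtain ⟨C, r, hC, hr0, hr1, hmain⟩ := corridor_transfer hη hβ₁
  obtain ⟨A, hA, L₀, hdata⟩ := corridorData_thermalFluxZc hη hβ₁ hZ
  refine ⟨θ₁, hθ₁, fun L => C * (A * (L : ℝ) ^ 2 + 1) * r ^ L, ?_, L₀, ?_⟩
  · -- `C (A L² + 1) r^L → 0`
    have h2 : Tendsto (fun L : ℕ => (L : ℝ) ^ 2 * r ^ L) atTop (𝓝 0) :=
      tendsto_pow_const_mul_const_pow_of_abs_lt_one 2 (by rw [abs_of_nonneg hr0]; exact hr1)
    have h0 : Tendsto (fun L : ℕ => r ^ L) atTop (𝓝 0) := tendsto_pow_atTop_nhds_zero_of_lt_one hr0 hr1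
    have : Tendsto (fun L : ℕ => C * (A * ((L : ℝ) ^ 2 * r ^ L) + r ^ L)) atTop (𝓝 (C * (A * 0 + 0))) :=
      ((h2.const_mul A).add h0).const_mul C
    simp only [mul_zero, add_zero] at this
    refine this.congr' (Eventually.of_forall fun L => ?_)
    ring
  · intro L _ hL θ hθ
    have h0θ : |(0 : ℝ)| ≤ θ₁ := by rw [abs_zero]; exact hθ₁.le
    have hfd := hdata L hL θ hθ
    have hgd := hdata L hL 0 h0θ
    have hflat := iteratedDeriv_thermalFluxZc_eq (hF L θ)
    have hML : 0 ≤ A * (L : ℝ) ^ 2 := by positivity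
    have key := hmain L (A * (L : ℝ) ^ 2) _ _ hML hfd hgd hflat
    rw [thermalFluxLogZ_eq_log_re, thermalFluxLogZ_eq_log_re, abs_sub_comm]
    exact key

/-- **K1 reading.** At the anchor `(t′, U, n) = (0, 8, 7/8)`: flux-blindness plus a zero-free strip around `[0, 10]` give the route crux
`ThermalStiffnessCeilingU8b10_le_1o8 := ObsThermalStiffnessSeqCeilingAtBeta 0 8 (7/8) 10 (1/8)` — indeed the leaf for every `c ≥ 0`. -/
theorem k1_of_zeroFreeStrip {η θ₁ : ℝ} (hη : 0 < η) (hθ₁ : 0 < θ₁)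
    (hF : ∀ (L : ℕ) [NeZero L] (θ : ℝ), FluxBlindTracePow L 0 8 (1 - 7 / 8) θ)
    (hZ : ZeroFreeStrip 0 8 (7 / 8) 10 η θ₁) :
    ObsThermalStiffnessSeqCeilingAtBeta 0 8 (7 / 8) 10 (1 / 8) :=
  leafAtBeta_of_twistInsensitiveAt (by norm_num) (by norm_num)
    (twistInsensitiveAt_of_zeroFreeStrip hη (by norm_num) hθ₁ hF hZ)

/-- **K2 (packet v4, BOX) reading.** A zero-free strip around `[0, 10]` at each `U` of the La box `[7.9, 14.7]` gives the consequent of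
`ThermalStiffnessCeilingBoxb10_le_9o71` directly (no `U`-transport). -/
theorem k2box_of_zeroFreeStrip
    (hF : ∀ (U : ℝ) (L : ℕ) [NeZero L] (θ : ℝ), FluxBlindTracePow L 0 U (1 - 7 / 8) θ)
    (hZ : ∀ U : ℝ, 79 / 10 ≤ U → U ≤ 147 / 10 → ∃ η θ₁ : ℝ, 0 < η ∧ 0 < θ₁ ∧ ZeroFreeStrip 0 U (7 / 8) 10 η θ₁) :
    ∀ U : ℝ, 79 / 10 ≤ U → U ≤ 147 / 10 → ObsThermalStiffnessSeqCeilingAtBeta 0 U (7 / 8) 10 (9 / 71) := by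
  intro U h1 h2
  obtain ⟨η, θ₁, hη, hθ₁, hZU⟩ := hZ U h1 h2
  exact leafAtBeta_of_twistInsensitiveAt (by norm_num) (by norm_num)
    (twistInsensitiveAt_of_zeroFreeStrip hη (by norm_num) hθ₁ (hF U) hZU)

/-- **K1 BY NAME.** The route crux `TcThermcert1.ThermalStiffnessCeilingU8b10_le_1o8` (stmt-Ventures-26381) from flux-blindness + the
zero-free strip at the anchor. -/
theorem k1_byName {η θ₁ : ℝ} (hη : 0 < η) (hθ₁ : 0 < θ₁)
    (hF : ∀ (L : ℕ) [NeZero L] (θ : ℝ), FluxBlindTracePow L 0 8 (1 - 7 / 8) θ)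
    (hZ : ZeroFreeStrip 0 8 (7 / 8) 10 η θ₁) :
    Summit.Ventures.CertifiedManyBodySolver.Theses.TcThermcert1.ThermalStiffnessCeilingU8b10_le_1o8 :=
  k1_of_zeroFreeStrip hη hθ₁ hF hZ

/-- **K2's consequent BY NAME (packet v4 box).** Zero-free strips on the box discharge `TcThermcert1.ThermalStiffnessCeilingBoxb10_le_9o71`
(stmt-Ventures-26382) outright — its K1-leaf antecedent is not even used. -/
theorem k2box_byName
    (hF : ∀ (U : ℝ) (L : ℕ) [NeZero L] (θ : ℝ), FluxBlindTracePow L 0 U (1 - 7 / 8) θ)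
    (hZ : ∀ U : ℝ, 79 / 10 ≤ U → U ≤ 147 / 10 → ∃ η θ₁ : ℝ, 0 < η ∧ 0 < θ₁ ∧ ZeroFreeStrip 0 U (7 / 8) 10 η θ₁) :
    Summit.Ventures.CertifiedManyBodySolver.Theses.TcThermcert1.ThermalStiffnessCeilingBoxb10_le_9o71 :=
  fun _ => k2box_of_zeroFreeStrip hF hZ

end Summit.Ventures.CertifiedManyBodySolver.Theses.TcThermcert1.ZeroFreeCorridor

end
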